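import Summits.CriticalPhenomena.PercolationContinuityZ3.Theorems.PercNearOneGluingNoHeavyLowerTailThreePartitionVOrderPrincipalTwisted

/-!
# THEOREM Π for ALL principal up-sets of a twisted copy order: the layer of twisted FREE coordinates

Support file (lineage `prim-bnk-2`, generation 33; `--supports stmt-CriticalPhenomena-4575`; memo
`run/shared/lean/prim/prim-l12/FROM-prim-bnk-2-g33-CONJ-W.md` §3f).  No `sorry`, no new definitions, standard axioms.

`…VOrderPrincipalTwisted` treats the faces above a FACE of the `τ`-twisted copy order.  A general principal up-set
`{(a,b) : a ⊇ a₀, b ⊇ b₀}` of the copy order may also contain twisted coordinates outside `a₀ ∪ b₀`; such a coordinate is FREE among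
its three twisted positions (absent from exactly one of the copies `a, b, c`).  Writing `(p,q,r)` for the ordered 3-partition of the
set `zt` of these coordinates (`p` = absent from `a`, `q` = absent from `b`, `r` = absent from `c`), the faces are
  `a = A ∪ q ∪ r ∪ g ∪ s`,  `b = B ∪ p ∪ r ∪ h ∪ t`,  `c = p ∪ q ∪ w ∪ (XZ \ s) ∪ (YZ \ t)`
with `(g,h,w) ⊢ z₀`, `s ⊆ XZ`, `t ⊆ YZ` as before.  **THEOREM Π (all principal up-sets, all twists)**
(`twistedPrincipalFree_kernelZ_sum_nonneg`): for `Z` monotone in each argument and 2-increasing, `YZ ⊆ A`, `XZ ⊆ B`, the sum of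
`K_Z(a,b,c) = 2Z(a,a) + Z(c,b) − Z(c,a) − Z(a,c) − Z(c,c)` over all these faces is `≥ 0`.  In particular the comb coefficient of every
PRINCIPAL FILTER is `≥ 0` at EVERY profile, for all up-sets `𝒱, 𝒲`.  PROOF: induction over `zt` with the termwise identities
`Σ_{e ∈ p,q,r} α_Z = α_Z + 2α_{Z₁₁}` and `Σ_{e∈p,q,r} β_Z = β_{Z₀₁} + β_{Z₁₀} + β_{Z₁₁} + (Z₁₁ − Z₁₀ − Z₀₁ + Z₀₀)(a,a)`
(`Z_{αβ}(S,T) = Z(S ∪ αe, T ∪ βe)`), on top of `twistedPrincipal_alpha_nonneg` / `twistedPrincipal_beta_nonneg`. [this work]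
-/

namespace Summit.CriticalPhenomena.PercolationContinuityZ3.Theorems.ThreePartition

open Finset

variable {ι : Type*} [DecidableEq ι]

/-- `α`-part with the layer of twisted free coordinates `zt`. [this work] -/
theorem twistedFree_alpha_nonneg (zt : Finset ι) :
    ∀ (Z : Finset ι → Finset ι → ℤ), (∀ S S' T, S ⊆ S' → Z S T ≤ Z S' T) → (∀ S T T', T ⊆ T' → Z S T ≤ Z S T') →
      ∀ (A XZ YZ z₀ : Finset ι), YZ ⊆ A →
      0 ≤ ∑ p ∈ zt.powerset, ∑ q ∈ (zt \ p).powerset, ∑ g ∈ z₀.powerset, ∑ h ∈ (z₀ \ g).powerset, ∑ s ∈ XZ.powerset, ∑ t ∈ YZ.powerset,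
          (Z (A ∪ q ∪ ((zt \ p) \ q) ∪ g ∪ s) (A ∪ q ∪ ((zt \ p) \ q) ∪ g ∪ s) - Z (p ∪ q ∪ (z₀ \ g) \ h ∪ XZ \ s ∪ YZ \ t) (p ∪ q ∪ (z₀ \ g) \ h ∪ XZ \ s ∪ YZ \ t)) := by
  induction zt using Finset.induction_on with
  | empty =>
    intro Z hl hr A XZ YZ z₀ hYA
    simp only [Finset.powerset_empty, Finset.sum_singleton, Finset.empty_sdiff, Finset.union_empty, Finset.empty_union]
    have h := twistedPrincipal_alpha_nonneg z₀ Z hl hr A XZ YZ hYA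
    refine le_trans h (le_of_eq ?_)
    refine Finset.sum_congr rfl fun g _ => Finset.sum_congr rfl fun h _ =>
      Finset.sum_congr rfl fun s _ => Finset.sum_congr rfl fun t _ => ?_
    simp only [Finset.union_assoc]
  | insert e zt he ih =>
    intro Z hl hr A XZ YZ z₀ hYA
    have h3 := sum_threePartitions_insert he (fun p q r => ∑ g ∈ z₀.powerset, ∑ h ∈ (z₀ \ g).powerset, ∑ s ∈ XZ.powerset, ∑ t ∈ YZ.powerset,
          (Z (A ∪ q ∪ r ∪ g ∪ s) (A ∪ q ∪ r ∪ g ∪ s) - Z (p ∪ q ∪ (z₀ \ g) \ h ∪ XZ \ s ∪ YZ \ t) (p ∪ q ∪ (z₀ \ g) \ h ∪ XZ \ s ∪ YZ \ t)))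
    rw [h3]
    have hl1 : ∀ S S' T : Finset ι, S ⊆ S' → Z (insert e S) (insert e T) ≤ Z (insert e S') (insert e T) :=
      fun S S' T hST => hl _ _ _ (Finset.insert_subset_insert e hST)
    have hr1 : ∀ S T T' : Finset ι, T ⊆ T' → Z (insert e S) (insert e T) ≤ Z (insert e S) (insert e T') :=
      fun S T T' hT => hr _ _ _ (Finset.insert_subset_insert e hT)
    have k0 := ih Z hl hr A XZ YZ z₀ hYA
    have k1 := ih (fun S T => Z (insert e S) (insert e T)) hl1 hr1 A XZ YZ z₀ hYA
    have hsplit : ∑ p ∈ zt.powerset, ∑ q ∈ (zt \ p).powerset, 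
        ((∑ g ∈ z₀.powerset, ∑ h ∈ (z₀ \ g).powerset, ∑ s ∈ XZ.powerset, ∑ t ∈ YZ.powerset,
          (Z (A ∪ q ∪ ((zt \ p) \ q) ∪ g ∪ s) (A ∪ q ∪ ((zt \ p) \ q) ∪ g ∪ s) - Z ((insert e p) ∪ q ∪ (z₀ \ g) \ h ∪ XZ \ s ∪ YZ \ t) ((insert e p) ∪ q ∪ (z₀ \ g) \ h ∪ XZ \ s ∪ YZ \ t))) +
         (∑ g ∈ z₀.powerset, ∑ h ∈ (z₀ \ g).powerset, ∑ s ∈ XZ.powerset, ∑ t ∈ YZ.powerset,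
          (Z (A ∪ (insert e q) ∪ ((zt \ p) \ q) ∪ g ∪ s) (A ∪ (insert e q) ∪ ((zt \ p) \ q) ∪ g ∪ s) - Z (p ∪ (insert e q) ∪ (z₀ \ g) \ h ∪ XZ \ s ∪ YZ \ t) (p ∪ (insert e q) ∪ (z₀ \ g) \ h ∪ XZ \ s ∪ YZ \ t))) +
         (∑ g ∈ z₀.powerset, ∑ h ∈ (z₀ \ g).powerset, ∑ s ∈ XZ.powerset, ∑ t ∈ YZ.powerset,
          (Z (A ∪ q ∪ (insert e ((zt \ p) \ q)) ∪ g ∪ s) (A ∪ q ∪ (insert e ((zt \ p) \ q)) ∪ g ∪ s) - Z (p ∪ q ∪ (z₀ \ g) \ h ∪ XZ \ s ∪ YZ \ t) (p ∪ q ∪ (z₀ \ g) \ h ∪ XZ \ s ∪ YZ \ t)))) =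
        (∑ p ∈ zt.powerset, ∑ q ∈ (zt \ p).powerset, ∑ g ∈ z₀.powerset, ∑ h ∈ (z₀ \ g).powerset, ∑ s ∈ XZ.powerset, ∑ t ∈ YZ.powerset,
          (Z (A ∪ q ∪ ((zt \ p) \ q) ∪ g ∪ s) (A ∪ q ∪ ((zt \ p) \ q) ∪ g ∪ s) - Z (p ∪ q ∪ (z₀ \ g) \ h ∪ XZ \ s ∪ YZ \ t) (p ∪ q ∪ (z₀ \ g) \ h ∪ XZ \ s ∪ YZ \ t))) +
        2 * (∑ p ∈ zt.powerset, ∑ q ∈ (zt \ p).powerset, ∑ g ∈ z₀.powerset, ∑ h ∈ (z₀ \ g).powerset, ∑ s ∈ XZ.powerset, ∑ t ∈ YZ.powerset,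
          (Z (insert e (A ∪ q ∪ ((zt \ p) \ q) ∪ g ∪ s)) (insert e (A ∪ q ∪ ((zt \ p) \ q) ∪ g ∪ s)) - Z (insert e (p ∪ q ∪ (z₀ \ g) \ h ∪ XZ \ s ∪ YZ \ t)) (insert e (p ∪ q ∪ (z₀ \ g) \ h ∪ XZ \ s ∪ YZ \ t)))) := by
      rw [Finset.mul_sum, ← Finset.sum_add_distrib]
      refine Finset.sum_congr rfl fun p _ => ?_
      rw [Finset.mul_sum, ← Finset.sum_add_distrib]
      refine Finset.sum_congr rfl fun q _ => ?_
      rw [Finset.mul_sum, ← Finset.sum_add_distrib, ← Finset.sum_add_distrib, ← Finset.sum_add_distrib]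
      refine Finset.sum_congr rfl fun g _ => ?_
      rw [Finset.mul_sum, ← Finset.sum_add_distrib, ← Finset.sum_add_distrib, ← Finset.sum_add_distrib]
      refine Finset.sum_congr rfl fun h _ => ?_
      rw [Finset.mul_sum, ← Finset.sum_add_distrib, ← Finset.sum_add_distrib, ← Finset.sum_add_distrib]
      refine Finset.sum_congr rfl fun s _ => ?_
      rw [Finset.mul_sum, ← Finset.sum_add_distrib, ← Finset.sum_add_distrib, ← Finset.sum_add_distrib]
      refine Finset.sum_congr rfl fun t _ => ?_
      simp only [Finset.union_insert, Finset.insert_union]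
      ring
    rw [hsplit]
    nlinarith [k0, k1]

/-- `β`-part with the layer of twisted free coordinates `zt`. [this work] -/
theorem twistedFree_beta_nonneg (zt : Finset ι) :
    ∀ (Z : Finset ι → Finset ι → ℤ), (∀ S S' T, S ⊆ S' → Z S T ≤ Z S' T) → (∀ S T T', T ⊆ T' → Z S T ≤ Z S T') →
      (∀ S S' T T', S ⊆ S' → T ⊆ T' → Z S' T + Z S T' ≤ Z S' T' + Z S T) →
      ∀ (A B XZ YZ z₀ : Finset ι), YZ ⊆ A → XZ ⊆ B →
      0 ≤ ∑ p ∈ zt.powerset, ∑ q ∈ (zt \ p).powerset, ∑ g ∈ z₀.powerset, ∑ h ∈ (z₀ \ g).powerset, ∑ s ∈ XZ.powerset, ∑ t ∈ YZ.powerset,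
          (Z (A ∪ q ∪ ((zt \ p) \ q) ∪ g ∪ s) (A ∪ q ∪ ((zt \ p) \ q) ∪ g ∪ s) - Z (A ∪ q ∪ ((zt \ p) \ q) ∪ g ∪ s) (p ∪ q ∪ (z₀ \ g) \ h ∪ XZ \ s ∪ YZ \ t) - Z (p ∪ q ∪ (z₀ \ g) \ h ∪ XZ \ s ∪ YZ \ t) (A ∪ q ∪ ((zt \ p) \ q) ∪ g ∪ s) + Z (p ∪ q ∪ (z₀ \ g) \ h ∪ XZ \ s ∪ YZ \ t) (B ∪ p ∪ ((zt \ p) \ q) ∪ h ∪ t)) := by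
  induction zt using Finset.induction_on with
  | empty =>
    intro Z hl hr hm A B XZ YZ z₀ hYA hXB
    simp only [Finset.powerset_empty, Finset.sum_singleton, Finset.empty_sdiff, Finset.union_empty, Finset.empty_union]
    have h := twistedPrincipal_beta_nonneg z₀ Z hl hr hm A B XZ YZ hYA hXB
    refine le_trans h (le_of_eq ?_)
    refine Finset.sum_congr rfl fun g _ => Finset.sum_congr rfl fun h _ =>
      Finset.sum_congr rfl fun s _ => Finset.sum_congr rfl fun t _ => ?_
    simp only [Finset.union_assoc]
  | insert e zt he ih =>
    intro Z hl hr hm A B XZ YZ z₀ hYA hXB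
    have h3 := sum_threePartitions_insert he (fun p q r => ∑ g ∈ z₀.powerset, ∑ h ∈ (z₀ \ g).powerset, ∑ s ∈ XZ.powerset, ∑ t ∈ YZ.powerset,
          (Z (A ∪ q ∪ r ∪ g ∪ s) (A ∪ q ∪ r ∪ g ∪ s) - Z (A ∪ q ∪ r ∪ g ∪ s) (p ∪ q ∪ (z₀ \ g) \ h ∪ XZ \ s ∪ YZ \ t) - Z (p ∪ q ∪ (z₀ \ g) \ h ∪ XZ \ s ∪ YZ \ t) (A ∪ q ∪ r ∪ g ∪ s) + Z (p ∪ q ∪ (z₀ \ g) \ h ∪ XZ \ s ∪ YZ \ t) (B ∪ p ∪ r ∪ h ∪ t)))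
    rw [h3]
    have hl01 : ∀ S S' T : Finset ι, S ⊆ S' → Z S (insert e T) ≤ Z S' (insert e T) := fun S S' T hST => hl _ _ _ hST
    have hr01 : ∀ S T T' : Finset ι, T ⊆ T' → Z S (insert e T) ≤ Z S (insert e T') :=
      fun S T T' hT => hr _ _ _ (Finset.insert_subset_insert e hT)
    have hm01 : ∀ S S' T T' : Finset ι, S ⊆ S' → T ⊆ T' →
        Z S' (insert e T) + Z S (insert e T') ≤ Z S' (insert e T') + Z S (insert e T) :=
      fun S S' T T' hS hT => hm _ _ _ _ hS (Finset.insert_subset_insert e hT)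
    have hl10 : ∀ S S' T : Finset ι, S ⊆ S' → Z (insert e S) T ≤ Z (insert e S') T :=
      fun S S' T hST => hl _ _ _ (Finset.insert_subset_insert e hST)
    have hr10 : ∀ S T T' : Finset ι, T ⊆ T' → Z (insert e S) T ≤ Z (insert e S) T' := fun S T T' hT => hr _ _ _ hT
    have hm10 : ∀ S S' T T' : Finset ι, S ⊆ S' → T ⊆ T' →
        Z (insert e S') T + Z (insert e S) T' ≤ Z (insert e S') T' + Z (insert e S) T :=
      fun S S' T T' hS hT => hm _ _ _ _ (Finset.insert_subset_insert e hS) hT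
    have hl11 : ∀ S S' T : Finset ι, S ⊆ S' → Z (insert e S) (insert e T) ≤ Z (insert e S') (insert e T) :=
      fun S S' T hST => hl _ _ _ (Finset.insert_subset_insert e hST)
    have hr11 : ∀ S T T' : Finset ι, T ⊆ T' → Z (insert e S) (insert e T) ≤ Z (insert e S) (insert e T') :=
      fun S T T' hT => hr _ _ _ (Finset.insert_subset_insert e hT)
    have hm11 : ∀ S S' T T' : Finset ι, S ⊆ S' → T ⊆ T' →
        Z (insert e S') (insert e T) + Z (insert e S) (insert e T') ≤ Z (insert e S') (insert e T') + Z (insert e S) (insert e T) :=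
      fun S S' T T' hS hT => hm _ _ _ _ (Finset.insert_subset_insert e hS) (Finset.insert_subset_insert e hT)
    have k01 := ih (fun S T => Z S (insert e T)) hl01 hr01 hm01 A B XZ YZ z₀ hYA hXB
    have k10 := ih (fun S T => Z (insert e S) T) hl10 hr10 hm10 A B XZ YZ z₀ hYA hXB
    have k11 := ih (fun S T => Z (insert e S) (insert e T)) hl11 hr11 hm11 A B XZ YZ z₀ hYA hXB
    have ksq : 0 ≤ ∑ p ∈ zt.powerset, ∑ q ∈ (zt \ p).powerset, ∑ g ∈ z₀.powerset, ∑ h ∈ (z₀ \ g).powerset, ∑ s ∈ XZ.powerset, ∑ t ∈ YZ.powerset,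
          (Z (insert e (A ∪ q ∪ ((zt \ p) \ q) ∪ g ∪ s)) (insert e (A ∪ q ∪ ((zt \ p) \ q) ∪ g ∪ s)) - Z (insert e (A ∪ q ∪ ((zt \ p) \ q) ∪ g ∪ s)) (A ∪ q ∪ ((zt \ p) \ q) ∪ g ∪ s)
            - Z (A ∪ q ∪ ((zt \ p) \ q) ∪ g ∪ s) (insert e (A ∪ q ∪ ((zt \ p) \ q) ∪ g ∪ s)) + Z (A ∪ q ∪ ((zt \ p) \ q) ∪ g ∪ s) (A ∪ q ∪ ((zt \ p) \ q) ∪ g ∪ s)) := by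
      refine Finset.sum_nonneg fun p _ => Finset.sum_nonneg fun q _ => Finset.sum_nonneg fun g _ =>
        Finset.sum_nonneg fun h _ => Finset.sum_nonneg fun s _ => Finset.sum_nonneg fun t _ => ?_
      have := hm (A ∪ q ∪ ((zt \ p) \ q) ∪ g ∪ s) (insert e (A ∪ q ∪ ((zt \ p) \ q) ∪ g ∪ s)) (A ∪ q ∪ ((zt \ p) \ q) ∪ g ∪ s) (insert e (A ∪ q ∪ ((zt \ p) \ q) ∪ g ∪ s)) (Finset.subset_insert e _) (Finset.subset_insert e _)
      linarith
    have hsplit : ∑ p ∈ zt.powerset, ∑ q ∈ (zt \ p).powerset, 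
        ((∑ g ∈ z₀.powerset, ∑ h ∈ (z₀ \ g).powerset, ∑ s ∈ XZ.powerset, ∑ t ∈ YZ.powerset,
          (Z (A ∪ q ∪ ((zt \ p) \ q) ∪ g ∪ s) (A ∪ q ∪ ((zt \ p) \ q) ∪ g ∪ s) - Z (A ∪ q ∪ ((zt \ p) \ q) ∪ g ∪ s) ((insert e p) ∪ q ∪ (z₀ \ g) \ h ∪ XZ \ s ∪ YZ \ t) - Z ((insert e p) ∪ q ∪ (z₀ \ g) \ h ∪ XZ \ s ∪ YZ \ t) (A ∪ q ∪ ((zt \ p) \ q) ∪ g ∪ s) + Z ((insert e p) ∪ q ∪ (z₀ \ g) \ h ∪ XZ \ s ∪ YZ \ t) (B ∪ (insert e p) ∪ ((zt \ p) \ q) ∪ h ∪ t))) +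
         (∑ g ∈ z₀.powerset, ∑ h ∈ (z₀ \ g).powerset, ∑ s ∈ XZ.powerset, ∑ t ∈ YZ.powerset,
          (Z (A ∪ (insert e q) ∪ ((zt \ p) \ q) ∪ g ∪ s) (A ∪ (insert e q) ∪ ((zt \ p) \ q) ∪ g ∪ s) - Z (A ∪ (insert e q) ∪ ((zt \ p) \ q) ∪ g ∪ s) (p ∪ (insert e q) ∪ (z₀ \ g) \ h ∪ XZ \ s ∪ YZ \ t) - Z (p ∪ (insert e q) ∪ (z₀ \ g) \ h ∪ XZ \ s ∪ YZ \ t) (A ∪ (insert e q) ∪ ((zt \ p) \ q) ∪ g ∪ s) + Z (p ∪ (insert e q) ∪ (z₀ \ g) \ h ∪ XZ \ s ∪ YZ \ t) (B ∪ p ∪ ((zt \ p) \ q) ∪ h ∪ t))) +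
         (∑ g ∈ z₀.powerset, ∑ h ∈ (z₀ \ g).powerset, ∑ s ∈ XZ.powerset, ∑ t ∈ YZ.powerset,
          (Z (A ∪ q ∪ (insert e ((zt \ p) \ q)) ∪ g ∪ s) (A ∪ q ∪ (insert e ((zt \ p) \ q)) ∪ g ∪ s) - Z (A ∪ q ∪ (insert e ((zt \ p) \ q)) ∪ g ∪ s) (p ∪ q ∪ (z₀ \ g) \ h ∪ XZ \ s ∪ YZ \ t) - Z (p ∪ q ∪ (z₀ \ g) \ h ∪ XZ \ s ∪ YZ \ t) (A ∪ q ∪ (insert e ((zt \ p) \ q)) ∪ g ∪ s) + Z (p ∪ q ∪ (z₀ \ g) \ h ∪ XZ \ s ∪ YZ \ t) (B ∪ p ∪ (insert e ((zt \ p) \ q)) ∪ h ∪ t)))) =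
        (∑ p ∈ zt.powerset, ∑ q ∈ (zt \ p).powerset, ∑ g ∈ z₀.powerset, ∑ h ∈ (z₀ \ g).powerset, ∑ s ∈ XZ.powerset, ∑ t ∈ YZ.powerset,
          (Z (A ∪ q ∪ ((zt \ p) \ q) ∪ g ∪ s) (insert e (A ∪ q ∪ ((zt \ p) \ q) ∪ g ∪ s)) - Z (A ∪ q ∪ ((zt \ p) \ q) ∪ g ∪ s) (insert e (p ∪ q ∪ (z₀ \ g) \ h ∪ XZ \ s ∪ YZ \ t)) - Z (p ∪ q ∪ (z₀ \ g) \ h ∪ XZ \ s ∪ YZ \ t) (insert e (A ∪ q ∪ ((zt \ p) \ q) ∪ g ∪ s)) + Z (p ∪ q ∪ (z₀ \ g) \ h ∪ XZ \ s ∪ YZ \ t) (insert e (B ∪ p ∪ ((zt \ p) \ q) ∪ h ∪ t)))) +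
        (∑ p ∈ zt.powerset, ∑ q ∈ (zt \ p).powerset, ∑ g ∈ z₀.powerset, ∑ h ∈ (z₀ \ g).powerset, ∑ s ∈ XZ.powerset, ∑ t ∈ YZ.powerset,
          (Z (insert e (A ∪ q ∪ ((zt \ p) \ q) ∪ g ∪ s)) (A ∪ q ∪ ((zt \ p) \ q) ∪ g ∪ s) - Z (insert e (A ∪ q ∪ ((zt \ p) \ q) ∪ g ∪ s)) (p ∪ q ∪ (z₀ \ g) \ h ∪ XZ \ s ∪ YZ \ t) - Z (insert e (p ∪ q ∪ (z₀ \ g) \ h ∪ XZ \ s ∪ YZ \ t)) (A ∪ q ∪ ((zt \ p) \ q) ∪ g ∪ s) + Z (insert e (p ∪ q ∪ (z₀ \ g) \ h ∪ XZ \ s ∪ YZ \ t)) (B ∪ p ∪ ((zt \ p) \ q) ∪ h ∪ t))) +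
        (∑ p ∈ zt.powerset, ∑ q ∈ (zt \ p).powerset, ∑ g ∈ z₀.powerset, ∑ h ∈ (z₀ \ g).powerset, ∑ s ∈ XZ.powerset, ∑ t ∈ YZ.powerset,
          (Z (insert e (A ∪ q ∪ ((zt \ p) \ q) ∪ g ∪ s)) (insert e (A ∪ q ∪ ((zt \ p) \ q) ∪ g ∪ s)) - Z (insert e (A ∪ q ∪ ((zt \ p) \ q) ∪ g ∪ s)) (insert e (p ∪ q ∪ (z₀ \ g) \ h ∪ XZ \ s ∪ YZ \ t)) - Z (insert e (p ∪ q ∪ (z₀ \ g) \ h ∪ XZ \ s ∪ YZ \ t)) (insert e (A ∪ q ∪ ((zt \ p) \ q) ∪ g ∪ s)) + Z (insert e (p ∪ q ∪ (z₀ \ g) \ h ∪ XZ \ s ∪ YZ \ t)) (insert e (B ∪ p ∪ ((zt \ p) \ q) ∪ h ∪ t)))) +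
        ∑ p ∈ zt.powerset, ∑ q ∈ (zt \ p).powerset, ∑ g ∈ z₀.powerset, ∑ h ∈ (z₀ \ g).powerset, ∑ s ∈ XZ.powerset, ∑ t ∈ YZ.powerset,
          (Z (insert e (A ∪ q ∪ ((zt \ p) \ q) ∪ g ∪ s)) (insert e (A ∪ q ∪ ((zt \ p) \ q) ∪ g ∪ s)) - Z (insert e (A ∪ q ∪ ((zt \ p) \ q) ∪ g ∪ s)) (A ∪ q ∪ ((zt \ p) \ q) ∪ g ∪ s)
            - Z (A ∪ q ∪ ((zt \ p) \ q) ∪ g ∪ s) (insert e (A ∪ q ∪ ((zt \ p) \ q) ∪ g ∪ s)) + Z (A ∪ q ∪ ((zt \ p) \ q) ∪ g ∪ s) (A ∪ q ∪ ((zt \ p) \ q) ∪ g ∪ s)) := by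
      rw [← Finset.sum_add_distrib, ← Finset.sum_add_distrib, ← Finset.sum_add_distrib]
      refine Finset.sum_congr rfl fun p _ => ?_
      rw [← Finset.sum_add_distrib, ← Finset.sum_add_distrib, ← Finset.sum_add_distrib]
      refine Finset.sum_congr rfl fun q _ => ?_
      rw [← Finset.sum_add_distrib, ← Finset.sum_add_distrib, ← Finset.sum_add_distrib,
        ← Finset.sum_add_distrib, ← Finset.sum_add_distrib]
      refine Finset.sum_congr rfl fun g _ => ?_
      rw [← Finset.sum_add_distrib, ← Finset.sum_add_distrib, ← Finset.sum_add_distrib,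
        ← Finset.sum_add_distrib, ← Finset.sum_add_distrib]
      refine Finset.sum_congr rfl fun h _ => ?_
      rw [← Finset.sum_add_distrib, ← Finset.sum_add_distrib, ← Finset.sum_add_distrib,
        ← Finset.sum_add_distrib, ← Finset.sum_add_distrib]
      refine Finset.sum_congr rfl fun s _ => ?_
      rw [← Finset.sum_add_distrib, ← Finset.sum_add_distrib, ← Finset.sum_add_distrib,
        ← Finset.sum_add_distrib, ← Finset.sum_add_distrib]
      refine Finset.sum_congr rfl fun t _ => ?_
      simp only [Finset.union_insert, Finset.insert_union]
      ring
    rw [hsplit]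
    nlinarith [k01, k10, k11, ksq]

/-- **THEOREM Π (all principal up-sets of a twisted copy order).**  For `Z : Finset ι → Finset ι → ℤ` monotone in each argument
and 2-increasing and `YZ ⊆ A`, `XZ ⊆ B`: the kernel `2Z(a,a) + Z(c,b) − Z(c,a) − Z(a,c) − Z(c,c)` summed over the faces
`a = A ∪ q ∪ r ∪ g ∪ s`, `b = B ∪ p ∪ r ∪ h ∪ t`, `c = p ∪ q ∪ w ∪ (XZ\s) ∪ (YZ\t)` (`(p,q,r) ⊢ zt` twisted free, `(g,h,w) ⊢ z₀`
untwisted free, `s ⊆ XZ`, `t ⊆ YZ`) is `≥ 0`. [this work] -/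
theorem twistedPrincipalFree_kernelZ_sum_nonneg (Z : Finset ι → Finset ι → ℤ)
    (hl : ∀ S S' T, S ⊆ S' → Z S T ≤ Z S' T) (hr : ∀ S T T', T ⊆ T' → Z S T ≤ Z S T')
    (hm : ∀ S S' T T', S ⊆ S' → T ⊆ T' → Z S' T + Z S T' ≤ Z S' T' + Z S T)
    (A B XZ YZ z₀ zt : Finset ι) (hYA : YZ ⊆ A) (hXB : XZ ⊆ B) :
    0 ≤ ∑ p ∈ zt.powerset, ∑ q ∈ (zt \ p).powerset, ∑ g ∈ z₀.powerset, ∑ h ∈ (z₀ \ g).powerset, ∑ s ∈ XZ.powerset, ∑ t ∈ YZ.powerset,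
          (2 * Z (A ∪ q ∪ ((zt \ p) \ q) ∪ g ∪ s) (A ∪ q ∪ ((zt \ p) \ q) ∪ g ∪ s) + Z (p ∪ q ∪ (z₀ \ g) \ h ∪ XZ \ s ∪ YZ \ t) (B ∪ p ∪ ((zt \ p) \ q) ∪ h ∪ t) - Z (p ∪ q ∪ (z₀ \ g) \ h ∪ XZ \ s ∪ YZ \ t) (A ∪ q ∪ ((zt \ p) \ q) ∪ g ∪ s) - Z (A ∪ q ∪ ((zt \ p) \ q) ∪ g ∪ s) (p ∪ q ∪ (z₀ \ g) \ h ∪ XZ \ s ∪ YZ \ t) - Z (p ∪ q ∪ (z₀ \ g) \ h ∪ XZ \ s ∪ YZ \ t) (p ∪ q ∪ (z₀ \ g) \ h ∪ XZ \ s ∪ YZ \ t)) := by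
  have hA := twistedFree_alpha_nonneg zt Z hl hr A XZ YZ z₀ hYA
  have hB := twistedFree_beta_nonneg zt Z hl hr hm A B XZ YZ z₀ hYA hXB
  have hsplit : ∑ p ∈ zt.powerset, ∑ q ∈ (zt \ p).powerset, ∑ g ∈ z₀.powerset, ∑ h ∈ (z₀ \ g).powerset, ∑ s ∈ XZ.powerset, ∑ t ∈ YZ.powerset,
          (2 * Z (A ∪ q ∪ ((zt \ p) \ q) ∪ g ∪ s) (A ∪ q ∪ ((zt \ p) \ q) ∪ g ∪ s) + Z (p ∪ q ∪ (z₀ \ g) \ h ∪ XZ \ s ∪ YZ \ t) (B ∪ p ∪ ((zt \ p) \ q) ∪ h ∪ t) - Z (p ∪ q ∪ (z₀ \ g) \ h ∪ XZ \ s ∪ YZ \ t) (A ∪ q ∪ ((zt \ p) \ q) ∪ g ∪ s) - Z (A ∪ q ∪ ((zt \ p) \ q) ∪ g ∪ s) (p ∪ q ∪ (z₀ \ g) \ h ∪ XZ \ s ∪ YZ \ t) - Z (p ∪ q ∪ (z₀ \ g) \ h ∪ XZ \ s ∪ YZ \ t) (p ∪ q ∪ (z₀ \ g) \ h ∪ XZ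 \ s ∪ YZ \ t)) =
      (∑ p ∈ zt.powerset, ∑ q ∈ (zt \ p).powerset, ∑ g ∈ z₀.powerset, ∑ h ∈ (z₀ \ g).powerset, ∑ s ∈ XZ.powerset, ∑ t ∈ YZ.powerset,
          (Z (A ∪ q ∪ ((zt \ p) \ q) ∪ g ∪ s) (A ∪ q ∪ ((zt \ p) \ q) ∪ g ∪ s) - Z (p ∪ q ∪ (z₀ \ g) \ h ∪ XZ \ s ∪ YZ \ t) (p ∪ q ∪ (z₀ \ g) \ h ∪ XZ \ s ∪ YZ \ t))) +
      ∑ p ∈ zt.powerset, ∑ q ∈ (zt \ p).powerset, ∑ g ∈ z₀.powerset, ∑ h ∈ (z₀ \ g).powerset, ∑ s ∈ XZ.powerset, ∑ t ∈ YZ.powerset,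
          (Z (A ∪ q ∪ ((zt \ p) \ q) ∪ g ∪ s) (A ∪ q ∪ ((zt \ p) \ q) ∪ g ∪ s) - Z (A ∪ q ∪ ((zt \ p) \ q) ∪ g ∪ s) (p ∪ q ∪ (z₀ \ g) \ h ∪ XZ \ s ∪ YZ \ t) - Z (p ∪ q ∪ (z₀ \ g) \ h ∪ XZ \ s ∪ YZ \ t) (A ∪ q ∪ ((zt \ p) \ q) ∪ g ∪ s) + Z (p ∪ q ∪ (z₀ \ g) \ h ∪ XZ \ s ∪ YZ \ t) (B ∪ p ∪ ((zt \ p) \ q) ∪ h ∪ t)) := by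
    rw [← Finset.sum_add_distrib]
    refine Finset.sum_congr rfl fun p _ => ?_
    rw [← Finset.sum_add_distrib]
    refine Finset.sum_congr rfl fun q _ => ?_
    rw [← Finset.sum_add_distrib]
    refine Finset.sum_congr rfl fun g _ => ?_
    rw [← Finset.sum_add_distrib]
    refine Finset.sum_congr rfl fun h _ => ?_
    rw [← Finset.sum_add_distrib]
    refine Finset.sum_congr rfl fun s _ => ?_
    rw [← Finset.sum_add_distrib]
    refine Finset.sum_congr rfl fun t _ => ?_
    ring
  rw [hsplit]
  exact add_nonneg hA hB

end Summit.CriticalPhenomena.PercolationContinuityZ3.Theorems.ThreePartition
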